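import Summits.QuantumFields.BalabanUV.Beta.D1BFx.GluonKernelSectors
import Summits.QuantumFields.BalabanUV.Beta.D1BFx.Criticality
import Summits.QuantumFields.BalabanUV.Beta.D1BFx.GluonLeg

/-!
# `BalabanUV.Beta.D1BFx.LamSectorUnfold` — road «BF-x» for binder row D1, slot (K), census group **G_Λ**: UNFOLDING THE LAGRANGE SECTOR
# `SbL` UNDER THE FINE BUBBLE, AND THE Λ₂-SLOT TABLE UNDER THE FINE TADPOLE, INTO `Σ_m Σ'_y Λ′ m y · (…)` — step Λ of an3-g53's
# LAMBDA-DICTIONARY v1 §4–§5 (the Fubini sockets of the owner's «LAM-DICT» BRICK 2, SPEC «K-END-RESHAPE-GROUPS» v1 §3 `hGrp gΛ`)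

HONEST DEPENDENCY (page 1, mandatory): continuum YM on T⁴ ⇐ BetaPertH ∧ nine spine estimates (0/9 proved); BetaPertH ⇐ (D1) ∧ (D4) ∧
CAP+tail; G-an2-4 gates asym, D1 and NE2/3/4.  HONEST FRAMING (cell contract, verbatim): «discharging `BetaPertH` makes Bałaban's UV
stability UNCONDITIONAL — a real constructive-QFT result; it is NOT the continuum limit and NOT the Clay problem.»  THIS MODULE DISCHARGES
NOTHING of the wall: [folklore] `tsum`∕Fubini bookkeeping BY NAME over the typed Lagrange sector `GluonKernelSectors.SbL`
(`= ffOf (SLam n (lamCoeffOf (KInv n) n) (hessFF n))`), `InterLevelTransport.onLat`∕`cwsum`, `OneStepResolventKernel.wsum`,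
`DressedBubbleBridge.bubble_wsum_left∕right`∕`tadpole_wsum_fst`, `BalabanStepJets.abs_lamCoeffOf_le` (`decays_KInv`),
`AveragingHessianKernels.biLoc_hessFF`, `TadpoleParity.tadpole_eq_zero_of_symm` + `GluonLeg.trK_Ga`.  No definition, no `Prop` minted,
nothing cited, no hypothesis is a printed statement, 0 sorry.  NO letter (in particular not the zero-momentum letter), NO bound, NO estimate;
the Λ₂-slot structure (the decomposition `WΛ = Λ′⊗TΛ + TΛ⊗Λ′ + WA`, the sockets of `TΛ`, the antisymmetry∕localisation of `WA`) is a
DISPLAYED HYPOTHESIS (an3-g53 §5: the instance is the future `WbfBal`'s business).  0 wall binders; (K) NOT closed; NOT D1, NOT `BetaPertH`,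
NOT continuum, NOT Clay.

ABSOLUTE RULE (cell charter, verbatim): «No internally-minted statement may enter as a cited fact. Every hypothesis is either kernel-proved in
this package or a verbatim quotation of a PUBLISHED theorem with page reference. The manuscript(s) under audit are NOT citable for their own
disputed steps — they are the thing under adjudication; programme-internal (2001/route/tribunal) claims are never citable.»

CONTENT ([folklore]; `Λ′ m y κ u := lamCoeffOf (KInv (N := n) (d := 3)) n m y κ u`, `Y m y := ffOf (hessFF n m y)`, `G := Ga n a`).
* §1 Extension-by-zero plumbing: `onLat_ffOf_apply`, `abs_onLat_le`, `summable_abs_onLat`, `biLoc_onLat`, `tsum_onLat_mul` (the `cwsum_apply` re-indexing).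
* §2 `exists_abs_lamCoeff_KInv_le` (the weight bound at `A := KInv n`), `SbL_eq_neg_sum_wsum` (THE LAGRANGE SECTOR AS A KERNEL:
  `SbL n κ u = −Σ_m wsum (onLat n (Λ′ m · κ u)) (onLat n (Y m ·))`), `loc_wsum_onLat_lam`;
  **`bubble_SbL_left`**: `bubble G (SbL n κ u) Z = −Σ_m Σ'_y Λ′ m y κ u · bubble G (Y m y) Z` (localised `Z`);
  **`bubble_SbL_right`**: `bubble G V (SbL n κ u) = −Σ_m Σ'_y Λ′ m y κ u · bubble G V (Y m y)` (localised `V`).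
* §3 **`tadpole_lamTable_eq`**: under the DISPLAYED Λ₂-slot structure — `WΛ κ u l u′ = Σ_m wsum (onLat n (Λ′ m · l u′)) (onLat n (TΛ m · κ u))
  + Σ_m wsum (onLat n (Λ′ m · κ u)) (onLat n (TΛ m · l u′)) + WA κ u l u′`, `TΛ m y κ u` bi-localised at its coarse bond, `WA κ u l u′` localised and
  transpose-ANTISYMMETRIC — `tadpole G (WΛ κ u l u′) = Σ_m Σ'_y Λ′ m y l u′ · tadpole G (TΛ m y κ u) + Σ_m Σ'_y Λ′ m y κ u · tadpole G (TΛ m y l u′)`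
  (the `WA` word has NO one-point function against the symmetric leg `G`: `tadpole_eq_zero_of_symm`).
Unit `b2b-balaban-gan24-formalise-leaf-05` (gen 40), G-an2-4 swarm leaf prover on cross-lane kernel duty for road «BF-x» (owner d1-p2, ruling ρ-g9-18).
-/

noncomputable section

namespace Summit.QuantumFields.BalabanUV.Beta.D1BFx.LamSectorUnfold

open Finset
open scoped BigOperators
open Literature.Probability.LatticeModels (Torus.proj)
open Literature.MathematicalPhysics.QuantumFieldTheory
open Literature.MathematicalPhysics.QuantumFieldTheory.Balaban1983to89
open Literature.MathematicalPhysics.QuantumFieldTheory.Balaban1983to89.Beta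
open LatticeForm (quo)
open B12Sec2to5 (l1 l1_nonneg)
open ExpKernelCalculus (Site MKer Decays BiLoc bubble tadpole summable_exp_shift')
open OneStepResolventKernel (Fib KInv wsum biLoc_wsum decays_KInv quo_zsmul eq_zsmul_quo_of_proj)
open InterLevelTransport (onLat onLat_zsmul onLat_off SLam cwsum)
open BalabanStepJets (lamCoeffOf abs_lamCoeffOf_le)
open AveragingHessianKernels (hessFF biLoc_hessFF)
open Summit.QuantumFields.BalabanUV.Beta.TameKernelCalculus (Spr Loc trK tadpole_add biLoc_of_le)
open Summit.QuantumFields.BalabanUV.Beta.KernelWardRelative (bubble_finset_sum_left loc_finset_sum tadpole_finset_sum)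
open KernelReflection (bubble_smul_left bubble_smul_right)
open Summit.QuantumFields.BalabanUV.Beta.D1BFx.DressedBubbleBridge (bubble_finset_sum_right bubble_wsum_left bubble_wsum_right tadpole_wsum_fst)
open Summit.QuantumFields.BalabanUV.Beta.D1BFx.FineStencilBF (ffOf ffOf_apply biLoc_ffOf)
open Summit.QuantumFields.BalabanUV.Beta.D1BFx.GluonLeg (Ga trK_Ga)
open Summit.QuantumFields.BalabanUV.Beta.D1BFx.GluonKernelSectors (SbL)
open Summit.QuantumFields.BalabanUV.Beta.D1BFx.TadpoleParity (tadpole_eq_zero_of_symm)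
open Summit.QuantumFields.BalabanUV.Beta.D1BFx.Criticality (tadpole_wsum)

/-! ## §1 Extension-by-zero plumbing on the fine lattice `ℤ⁴` -/

section OnLat

variable (n : ℕ) [NeZero n] {F : Type*}

omit [NeZero n] in
/-- [folklore] `ffOf` passes through the extension by zero (entrywise). -/
theorem onLat_ffOf_apply (Q : Site 4 → MKer 4 (Fib 3)) (v x z : Site 4) (α β : Fin 4) :
    onLat n (fun y => ffOf (Q y)) v x z α β = onLat n Q v x z (Sum.inl α) (Sum.inl β) := by
  unfold onLat
  split_ifs <;> rfl

/-- [folklore] A coarse-indexed weight decaying in fine units from `p`, extended by zero, decays from `p` on the fine lattice. -/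
theorem abs_onLat_le {w : Site 4 → ℝ} {C δ : ℝ} {p : Site 4} (hC : 0 ≤ C) (hw : ∀ y, |w y| ≤ C * Real.exp (-δ * l1 ((n : ℤ) • y - p)))
    (v : Site 4) : |onLat n w v| ≤ C * Real.exp (-δ * l1 (v - p)) := by
  by_cases hv : Torus.proj n v = 0
  · have e := eq_zsmul_quo_of_proj (N := n) hv
    simp only [onLat, hv, if_true]
    have h := hw (quo n v)
    rwa [← e] at h
  · rw [onLat_off w hv, abs_zero]
    positivity

/-- [folklore] Hence the extended weight is absolutely summable. -/
theorem summable_abs_onLat {w : Site 4 → ℝ} {C δ : ℝ} {p : Site 4} (hC : 0 ≤ C) (hδ : 0 < δ)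
    (hw : ∀ y, |w y| ≤ C * Real.exp (-δ * l1 ((n : ℤ) • y - p))) : Summable fun v => |onLat n w v| :=
  Summable.of_nonneg_of_le (fun _ => abs_nonneg _) (abs_onLat_le n hC hw) ((summable_exp_shift' hδ p).mul_left C)

/-- [folklore] A coarse-indexed kernel family bi-localised at its coarse point, extended by zero, is bi-localised at its fine index. -/
theorem biLoc_onLat {Q : Site 4 → MKer 4 F} {Cq δ : ℝ} (hCq : 0 ≤ Cq) (hQ : ∀ y, BiLoc (Q y) ((n : ℤ) • y) ((n : ℤ) • y) Cq δ)
    (v : Site 4) : BiLoc (onLat n Q v) v v Cq δ := by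
  by_cases hv : Torus.proj n v = 0
  · have e := eq_zsmul_quo_of_proj (N := n) hv
    simp only [onLat, hv, if_true]
    have h := hQ (quo n v)
    rwa [← e] at h
  · intro x z a b
    rw [onLat_off Q hv]
    show |(0 : ℝ)| ≤ _
    rw [abs_zero]
    positivity

/-- [folklore] Re-indexing a fine sum against an extended weight as the coarse sum (the `cwsum_apply` pattern). -/
theorem tsum_onLat_mul (w : Site 4 → ℝ) (H : Site 4 → ℝ) :
    ∑' v, onLat n w v * H v = ∑' y, w y * H ((n : ℤ) • y) := by
  have hinj : Function.Injective (fun y : Site 4 => (n : ℤ) • y) := by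
    intro y y' h
    have := congrArg (quo n) h
    simpa only [quo_zsmul] using this
  rw [← hinj.tsum_eq (f := fun v => onLat n w v * H v)]
  · exact tsum_congr fun y => by simp only [onLat_zsmul]
  · intro v hv
    by_cases h0 : Torus.proj n v = 0
    · exact ⟨quo n v, (eq_zsmul_quo_of_proj (N := n) h0).symm⟩
    · refine (Function.mem_support.mp hv ?_).elim
      show onLat n w v * H v = 0
      rw [onLat_off w h0, zero_mul]

end OnLat

/-! ## §2 The Lagrange sector under the fine bubble -/

section Lam

variable (n : ℕ) [NeZero n] (a : ℝ)

/-- [folklore] **THE WEIGHT BOUND**: the multiplier-response coefficients of the road, `Λ′ m y κ u = lamCoeffOf (KInv n) n m y κ u`, decay in fine units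
from the perturbed fine bond (`abs_lamCoeffOf_le` at `decays_KInv`), with ONE nonnegative constant and ONE positive rate. -/
theorem exists_abs_lamCoeff_KInv_le : ∃ C δ : ℝ, 0 ≤ C ∧ 0 < δ ∧ ∀ (m : Fin 4) (y : Site 4) (κ : Fin 4) (u : Site 4),
    |lamCoeffOf (KInv (N := n) (d := 3)) n m y κ u| ≤ C * Real.exp (-δ * l1 ((n : ℤ) • y - u)) := by
  obtain ⟨δ, C, hδ, hC, hA⟩ := decays_KInv (N := n) (d := 3)
  refine ⟨(3 : ℝ) ^ (3 + 1) * ((3 + 1 : ℕ) : ℝ) * (16 * ((3 + 1 : ℕ) : ℝ)) * C * Real.exp (((3 + 1 : ℕ) : ℝ) * δ), δ, by positivity, hδ,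
    fun m y κ u => abs_lamCoeffOf_le hA hC hδ.le m y κ u⟩

/-- [folklore] **THE LAGRANGE SECTOR AS A KERNEL**: `SbL n κ u = −Σ_m wsum (onLat n (Λ′ m · κ u)) (onLat n (y ↦ ffOf (hessFF n m y)))` — the definition
`ffOf ∘ SLam` with `cwsum = wsum ∘ onLat` unfolded and `ffOf` passed inside (entrywise bookkeeping, no summability needed). -/
theorem SbL_eq_neg_sum_wsum (κ : Fin 4) (u : Site 4) :
    SbL n κ u = -∑ m : Fin 4, wsum (onLat n (fun y => lamCoeffOf (KInv (N := n) (d := 3)) n m y κ u))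
      (fun v => onLat n (fun y => ffOf (hessFF n m y)) v) := by
  funext x z α β
  simp only [SbL, ffOf_apply, SLam, cwsum, wsum, Pi.neg_apply, Finset.sum_apply]
  congr 1
  refine Finset.sum_congr rfl fun m _ => tsum_congr fun v => ?_
  exact congrArg₂ (· * ·) rfl (onLat_ffOf_apply n (fun y => hessFF n m y) v x z α β).symm

variable {a}

/-- [folklore] Each `m`-term of the Lagrange sector is localised (bi-localised at the bond by `biLoc_wsum`). -/
theorem loc_wsum_onLat_lam (m κ : Fin 4) (u : Site 4) :
    Loc (wsum (onLat n (fun y => lamCoeffOf (KInv (N := n) (d := 3)) n m y κ u)) (fun v => onLat n (fun y => ffOf (hessFF n m y)) v)) := by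
  obtain ⟨C, δ, hC, hδ, hw⟩ := exists_abs_lamCoeff_KInv_le n
  have hn : 1 ≤ n := NeZero.one_le
  have hY := fun y : Site 4 => biLoc_ffOf (biLoc_hessFF (d := 3) hn m y hδ.le)
  exact ⟨u, u, _, δ / 2, half_pos hδ,
    biLoc_wsum (abs_onLat_le n hC (fun y => hw m y κ u)) (biLoc_onLat n ((hY 0).nonneg (0 : Fin 4)) hY) hδ hC⟩

/-- [folklore] **THE LAGRANGE SECTOR IN THE FIRST SLOT OF THE FINE BUBBLE**: for the spread gluon leg `G = Ga n a` and a localised partner `Z`,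
`bubble G (SbL n κ u) Z = −Σ_m Σ'_y Λ′ m y κ u · bubble G (ffOf (hessFF n m y)) Z`. -/
theorem bubble_SbL_left (hGa : Spr (Ga n a)) {Z : MKer 4 (Fin 4)} (hZ : Loc Z) (κ : Fin 4) (u : Site 4) :
    bubble (Ga n a) (SbL n κ u) Z = -∑ m : Fin 4, ∑' y : Site 4,
      lamCoeffOf (KInv (N := n) (d := 3)) n m y κ u * bubble (Ga n a) (ffOf (hessFF n m y)) Z := by
  obtain ⟨C, δ, hC, hδ, hw⟩ := exists_abs_lamCoeff_KInv_le n
  have hn : 1 ≤ n := NeZero.one_le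
  have hY := fun (m : Fin 4) (y : Site 4) => biLoc_ffOf (biLoc_hessFF (d := 3) hn m y hδ.le)
  rw [SbL_eq_neg_sum_wsum, ← neg_one_smul ℝ (∑ m : Fin 4, _), bubble_smul_left,
    bubble_finset_sum_left univ hGa (fun m => loc_wsum_onLat_lam n m κ u) hZ, neg_one_mul]
  congr 1
  refine Finset.sum_congr rfl fun m _ => ?_
  rw [bubble_wsum_left hGa hZ (summable_abs_onLat n hC hδ (fun y => hw m y κ u)) (biLoc_onLat n ((hY m 0).nonneg (0 : Fin 4)) (hY m)) hδ,
    tsum_onLat_mul]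
  exact tsum_congr fun y => by rw [onLat_zsmul]

/-- [folklore] **THE LAGRANGE SECTOR IN THE SECOND SLOT OF THE FINE BUBBLE**: for a localised partner `V`,
`bubble G V (SbL n κ u) = −Σ_m Σ'_y Λ′ m y κ u · bubble G V (ffOf (hessFF n m y))`. -/
theorem bubble_SbL_right (hGa : Spr (Ga n a)) {V : MKer 4 (Fin 4)} (hV : Loc V) (κ : Fin 4) (u : Site 4) :
    bubble (Ga n a) V (SbL n κ u) = -∑ m : Fin 4, ∑' y : Site 4,
      lamCoeffOf (KInv (N := n) (d := 3)) n m y κ u * bubble (Ga n a) V (ffOf (hessFF n m y)) := by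
  obtain ⟨C, δ, hC, hδ, hw⟩ := exists_abs_lamCoeff_KInv_le n
  have hn : 1 ≤ n := NeZero.one_le
  have hY := fun (m : Fin 4) (y : Site 4) => biLoc_ffOf (biLoc_hessFF (d := 3) hn m y hδ.le)
  rw [SbL_eq_neg_sum_wsum, ← neg_one_smul ℝ (∑ m : Fin 4, _), bubble_smul_right,
    bubble_finset_sum_right univ hGa hV (fun m => loc_wsum_onLat_lam n m κ u), neg_one_mul]
  congr 1
  refine Finset.sum_congr rfl fun m _ => ?_
  rw [bubble_wsum_right hGa hV (summable_abs_onLat n hC hδ (fun y => hw m y κ u)) (biLoc_onLat n ((hY m 0).nonneg (0 : Fin 4)) (hY m)) hδ,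
    tsum_onLat_mul]
  exact tsum_congr fun y => by rw [onLat_zsmul]

end Lam

/-! ## §3 The Λ₂-slot table under the fine tadpole -/

section LamTwo

variable (n : ℕ) [NeZero n] {a : ℝ}

/-- [folklore] **THE Λ₂-SLOT TABLE IN THE FINE TADPOLE, UNDER THE DISPLAYED Λ₂ STRUCTURE** (an3-g53 §5 (hWΛ-dec)∕(hTΛ-loc)∕(hWA-anti)∕(hWA-loc)):
if `WΛ κ u l u′ = Σ_m wsum (onLat n (Λ′ m · l u′)) (onLat n (TΛ m · κ u)) + Σ_m wsum (onLat n (Λ′ m · κ u)) (onLat n (TΛ m · l u′)) + WA κ u l u′` with the companion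
tables `TΛ m y κ u` bi-localised at their coarse bond `(n•y, n•y)` (amplitude decaying from the fine bond) and `WA` localised and transpose-antisymmetric, then for the
spread SYMMETRIC gluon leg `G = Ga n a` (`0 < a`):
`tadpole G (WΛ κ u l u′) = Σ_m Σ'_y Λ′ m y l u′ · tadpole G (TΛ m y κ u) + Σ_m Σ'_y Λ′ m y κ u · tadpole G (TΛ m y l u′)` — the `WA` word drops by parity. -/
theorem tadpole_lamTable_eq (ha : 0 < a) (hGa : Spr (Ga n a)) {WΛ : Fin 4 → Site 4 → Fin 4 → Site 4 → MKer 4 (Fin 4)}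
    {TΛ : Fin 4 → Site 4 → Fin 4 → Site 4 → MKer 4 (Fin 4)} {WA : Fin 4 → Site 4 → Fin 4 → Site 4 → MKer 4 (Fin 4)} {CT δT : ℝ} (hδT : 0 < δT)
    (hdec : ∀ κ u l u', WΛ κ u l u' =
      (∑ m : Fin 4, wsum (onLat n (fun y => lamCoeffOf (KInv (N := n) (d := 3)) n m y l u')) (fun v => onLat n (fun y => TΛ m y κ u) v))
      + (∑ m : Fin 4, wsum (onLat n (fun y => lamCoeffOf (KInv (N := n) (d := 3)) n m y κ u)) (fun v => onLat n (fun y => TΛ m y l u') v))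
      + WA κ u l u')
    (hTloc : ∀ m y κ u, BiLoc (TΛ m y κ u) ((n : ℤ) • y) ((n : ℤ) • y) (CT * Real.exp (-δT * l1 ((n : ℤ) • y - u))) δT)
    (hWAa : ∀ κ u l u', trK (WA κ u l u') = -WA κ u l u') (hWAl : ∀ κ u l u', Loc (WA κ u l u'))
    (κ : Fin 4) (u : Site 4) (l : Fin 4) (u' : Site 4) :
    tadpole (Ga n a) (WΛ κ u l u') =
      (∑ m : Fin 4, ∑' y : Site 4, lamCoeffOf (KInv (N := n) (d := 3)) n m y l u' * tadpole (Ga n a) (TΛ m y κ u))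
      + ∑ m : Fin 4, ∑' y : Site 4, lamCoeffOf (KInv (N := n) (d := 3)) n m y κ u * tadpole (Ga n a) (TΛ m y l u') := by
  obtain ⟨C, δ, hC, hδ, hw⟩ := exists_abs_lamCoeff_KInv_le n
  have hn : 1 ≤ n := NeZero.one_le
  have hCT : 0 ≤ CT := by
    have h := (hTloc 0 0 0 0).nonneg (0 : Fin 4)
    have hpos : (0 : ℝ) < Real.exp (-δT * l1 ((n : ℤ) • (0 : Site 4) - 0)) := Real.exp_pos _
    nlinarith
  -- the companion tables with the decay of the amplitude dropped: uniformly bi-localised at the coarse bond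
  have hT : ∀ (m : Fin 4) (κ : Fin 4) (u : Site 4) (y : Site 4), BiLoc (TΛ m y κ u) ((n : ℤ) • y) ((n : ℤ) • y) CT δT := by
    intro m κ u y x z a b
    refine (hTloc m y κ u x z a b).trans (mul_le_mul_of_nonneg_right ?_ (Real.exp_pos _).le)
    exact mul_le_of_le_one_right hCT (Real.exp_le_one_iff.2 (by nlinarith [l1_nonneg ((n : ℤ) • y - u)]))
  -- a common rate for the weights and the companion tables, to localise each superposed term
  have hδ₀ : 0 < min δ δT := lt_min hδ hδT
  have hw₀ : ∀ (m : Fin 4) (y : Site 4) (κ : Fin 4) (u : Site 4),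
      |lamCoeffOf (KInv (N := n) (d := 3)) n m y κ u| ≤ C * Real.exp (-(min δ δT) * l1 ((n : ℤ) • y - u)) := fun m y κ u =>
    (hw m y κ u).trans (mul_le_mul_of_nonneg_left (Real.exp_le_exp.2 (by nlinarith [l1_nonneg ((n : ℤ) • y - u), min_le_left δ δT])) hC)
  have hlocT : ∀ (m κ : Fin 4) (u : Site 4) (l : Fin 4) (u' : Site 4),
      Loc (wsum (onLat n (fun y => lamCoeffOf (KInv (N := n) (d := 3)) n m y l u')) (fun v => onLat n (fun y => TΛ m y κ u) v)) :=
    fun m κ u l u' => ⟨u', u', _, min δ δT / 2, half_pos hδ₀,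
      biLoc_wsum (abs_onLat_le n hC (fun y => hw₀ m y l u'))
        (biLoc_onLat n (abs_nonneg CT) (fun y => biLoc_of_le (hT m κ u y) (min_le_right δ δT))) hδ₀ hC⟩
  have h1 : ∀ m : Fin 4, Loc (wsum (onLat n (fun y => lamCoeffOf (KInv (N := n) (d := 3)) n m y l u')) (fun v => onLat n (fun y => TΛ m y κ u) v)) :=
    fun m => hlocT m κ u l u'
  have h2 : ∀ m : Fin 4, Loc (wsum (onLat n (fun y => lamCoeffOf (KInv (N := n) (d := 3)) n m y κ u)) (fun v => onLat n (fun y => TΛ m y l u') v)) :=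
    fun m => hlocT m l u' κ u
  rw [hdec κ u l u', tadpole_add hGa ((loc_finset_sum univ h1).add (loc_finset_sum univ h2)) (hWAl κ u l u'),
    tadpole_add hGa (loc_finset_sum univ h1) (loc_finset_sum univ h2),
    tadpole_eq_zero_of_symm hGa (trK_Ga n a hn ha) (hWAl κ u l u') (hWAa κ u l u'), add_zero,
    tadpole_finset_sum univ hGa h1, tadpole_finset_sum univ hGa h2]
  congr 1
  · refine Finset.sum_congr rfl fun m _ => ?_
    rw [tadpole_wsum hGa hδ (abs_onLat_le n hC (fun y => hw m y l u')) hδT (biLoc_onLat n hCT (hT m κ u)), tsum_onLat_mul]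
    exact tsum_congr fun y => by rw [onLat_zsmul]
  · refine Finset.sum_congr rfl fun m _ => ?_
    rw [tadpole_wsum hGa hδ (abs_onLat_le n hC (fun y => hw m y κ u)) hδT (biLoc_onLat n hCT (hT m l u')), tsum_onLat_mul]
    exact tsum_congr fun y => by rw [onLat_zsmul]

end LamTwo

end Summit.QuantumFields.BalabanUV.Beta.D1BFx.LamSectorUnfold

end
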